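import Summits.CriticalPhenomena.Ising3DConformalLimit.Theorems.EnergyNotSigmaSquaredGapForcesFarMergingScreeningDefsAnnular
import Summits.CriticalPhenomena.Ising3DConformalLimit.Theorems.EnergyNotSigmaSquaredGapForcesFarMergingScreeningDecay

/-!
# One-pinch screening decay along powers of two
(line `screening-form-lemma-a1` of crux `GapForcesFarMerging`, item stmt-CriticalPhenomena-4468;
stub `stub_decayDyadic`)

Statement: `ScreeningIdentity → OnePinchGap → OnePinchScreeningDecayDyadic`. In words: if the one-pinch
truncated correlation `⟨σ₀σ_{e₂} ; σ_{up m}σ_{dn m}⟩` is `≤ C(2m)^{-κ'}G(2me₁)²` (`OnePinchGap`), then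
along infinitely many DYADIC far scales `m = 2^i`, eventually in the box size `n`, the full one-pinch mean
screening `pinchScreen n n (2^i)` (which the dictionary `ScreeningIdentity` identifies with the box
two-current avoidance probability `1 - P^{0 up, e₂ dn}_{Λ_n}[0 ↔ e₂]`) is `≤ C' (2^i)^{-κ'}`.

This is the landed `stub_screeningDecay` (`Theorems/…ScreeningDecay.lean`) read along powers of two. Its
proof is re-run verbatim, in two pieces:
1. the doubling pigeonhole along ANY geometric sequence `m₀4^k` (`exists_doubling_geom`): some `k` has
   `G(2m₀4^k e₁) ≤ 64·G(8m₀4^k e₁)` — otherwise `G(2m₀4^k e₁) < 64^{-k}`, against the lower bound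
   `G(x) ≥ c‖x‖⁻²` (`criticalTwoPoint_bounds`); started at `m₀ = 2^{i₀}` the sequence `2^{i₀+2k}` stays
   dyadic, whence `frequently_doubling_dyadic`;
2. the per-scale estimate at a doubling scale `m` (`eventually_pinchScreen_le_of_doubling`): energy
   factorisation (ADC21 (3.11)) + the gap, Messager–Miracle-Solé in the sup norm, box passage
   `P_{Λ_n}[0 ↔ e₂] → P_∞[0 ↔ e₂]` and the dictionary `ScreeningIdentity` — literally the body of the
   landed proof.

References: M. Aizenman, H. Duminil-Copin, Ann. Math. 194 (2021), eqs. (3.11), (5.3), Lemma A.1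
[AizenmanDuminilCopinAnnals2021]; A. Messager, S. Miracle-Solé, J. Stat. Phys. 17 (1977)
[MessagerMiracleSoleJSP1977].
-/

noncomputable section

namespace Summit.CriticalPhenomena.Ising3DConformalLimit.EnergyNotSigmaSquaredGapForcesFarMerging

open scoped symmDiff ENNReal
open MeasureTheory Filter Finset
open Literature.Probability.LatticeModels Literature.Probability.Percolation
open Summit.CriticalPhenomena.Ising3DConformalLimit.Theorems.GapForcesFarMerging.Negative
  (e₁ e₂ cc2 xR up dn FarMergingShape SinglePinchLawShape softPackageNoBubble_criticalCorr)
open Summit.CriticalPhenomena.Ising3DConformalLimit.GapForcesFarMergingScreening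

/-! ### The doubling pigeonhole along a geometric sequence -/

/-- **A doubling scale on every geometric sequence.** For `m₀ ≥ 1` some `k` has
`⟨σ₀σ_{2m₀4^k e₁}⟩ ≤ 64·⟨σ₀σ_{8m₀4^k e₁}⟩`: otherwise `⟨σ₀σ_{2m₀4^k e₁}⟩ < 64^{-k}` for all `k`, which
contradicts the lower bound `⟨σ₀σ_x⟩_{β_c} ≥ c‖x‖⁻²` of the critical two-point function of `ℤ³`
(`64^{-k} = o(16^{-k})`). The argument of the landed `frequently_doubling`, with the starting scale free. [folklore] -/
theorem exists_doubling_geom {m₀ : ℕ} (hm₀1 : 1 ≤ m₀) :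
    ∃ k : ℕ, cc2 0 (xR (m₀ * 4 ^ k)) ≤ 64 * cc2 0 (xR (4 * (m₀ * 4 ^ k))) := by
  obtain ⟨c, hc, hlow⟩ := softPackageNoBubble_criticalCorr.lower
  by_contra hcon
  push Not at hcon
  -- geometric decay along `m₀ 4^k`
  have hdec : ∀ k : ℕ, cc2 0 (xR (m₀ * 4 ^ k)) ≤ (((1 : ℝ) / 4) ^ k) ^ 3 := by
    intro k
    induction k with
    | zero => simpa using softPackageNoBubble_criticalCorr.le_one 0 (xR m₀)
    | succ k ih =>
      have h := hcon k
      have heq : m₀ * 4 ^ (k + 1) = 4 * (m₀ * 4 ^ k) := by ring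
      have hstep : (((1 : ℝ) / 4) ^ (k + 1)) ^ 3 = (((1 : ℝ) / 4) ^ k) ^ 3 / 64 := by ring
      rw [heq, hstep]
      linarith
  -- the polynomial lower bound along `m₀ 4^k`
  have hlow' : ∀ k : ℕ,
      c * ((2 * (m₀ : ℝ)) ^ 2)⁻¹ * (((1 : ℝ) / 4) ^ k) ^ 2 ≤ cc2 0 (xR (m₀ * 4 ^ k)) := by
    intro k
    have hm0 : (0 : ℤ) < m₀ := by exact_mod_cast hm₀1
    have hx : xR (m₀ * 4 ^ k) ≠ 0 := by
      intro h
      have h0 := congrFun h 0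
      have h1 : (xR (m₀ * 4 ^ k)) 0 = 2 * ((m₀ * 4 ^ k : ℕ) : ℤ) := by simp [xR]
      rw [h1, Pi.zero_apply] at h0
      push_cast at h0
      have h2 : (0 : ℤ) < 2 * ((m₀ : ℤ) * 4 ^ k) := mul_pos two_pos (mul_pos hm0 (pow_pos (by norm_num) k))
      linarith
    have h := hlow _ hx
    rw [norm_xR] at h
    have hm0' : (0 : ℝ) < m₀ := by exact_mod_cast hm₀1
    have hrpow : (2 * ((m₀ * 4 ^ k : ℕ) : ℝ)) ^ (-(2 : ℝ)) =
        ((2 * (m₀ : ℝ)) ^ 2)⁻¹ * (((1 : ℝ) / 4) ^ k) ^ 2 := by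
      rw [Real.rpow_neg (by positivity), Real.rpow_two]
      push_cast
      rw [one_div, inv_pow, inv_pow, ← mul_inv]
      congr 1
      ring
    calc c * ((2 * (m₀ : ℝ)) ^ 2)⁻¹ * (((1 : ℝ) / 4) ^ k) ^ 2
        = c * (2 * ((m₀ * 4 ^ k : ℕ) : ℝ)) ^ (-(2 : ℝ)) := by rw [hrpow, mul_assoc]
      _ ≤ cc2 0 (xR (m₀ * 4 ^ k)) := h
  -- comparison: `c (2m₀)⁻² ≤ 4^{-k}` for all `k`, absurd
  have hkey : ∀ k : ℕ, c * ((2 * (m₀ : ℝ)) ^ 2)⁻¹ ≤ ((1 : ℝ) / 4) ^ k := by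
    intro k
    have ht : (0 : ℝ) < (((1 : ℝ) / 4) ^ k) ^ 2 := by positivity
    have h := (hlow' k).trans (hdec k)
    rw [show (((1 : ℝ) / 4) ^ k) ^ 3 = ((1 : ℝ) / 4) ^ k * (((1 : ℝ) / 4) ^ k) ^ 2 by ring] at h
    exact le_of_mul_le_mul_right h ht
  have hA : (0 : ℝ) < c * ((2 * (m₀ : ℝ)) ^ 2)⁻¹ := by
    have : (0 : ℝ) < m₀ := by exact_mod_cast hm₀1
    positivity
  obtain ⟨k, hk⟩ := exists_pow_lt_of_lt_one hA (by norm_num : (1 : ℝ) / 4 < 1)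
  exact absurd (hkey k) (not_le.2 hk)

/-- **Dyadic doubling scales are unbounded.** For infinitely many `i`,
`⟨σ₀σ_{2·2^i e₁}⟩ ≤ 64·⟨σ₀σ_{8·2^i e₁}⟩`: start the geometric sequence of `exists_doubling_geom` at
`m₀ = 2^{i₀}`, so that `m₀4^k = 2^{i₀+2k}` stays a power of two. [folklore] -/
theorem frequently_doubling_dyadic :
    ∃ᶠ i : ℕ in atTop, cc2 0 (xR (2 ^ i)) ≤ 64 * cc2 0 (xR (4 * 2 ^ i)) := by
  rw [Filter.frequently_atTop]
  intro a
  obtain ⟨k, hk⟩ := exists_doubling_geom (m₀ := 2 ^ a) Nat.one_le_two_pow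
  refine ⟨a + 2 * k, Nat.le_add_right a _, ?_⟩
  have hpow : 2 ^ (a + 2 * k) = 2 ^ a * 4 ^ k := by
    rw [pow_add, pow_mul]
    norm_num
  rw [hpow]
  exact hk

/-! ### The per-scale estimate at a doubling scale -/

/-- **Screening decay at one doubling scale.** If `OnePinchGap` holds with constants `(κ, C)` and `m ≥ 1` is
a doubling scale (`⟨σ₀σ_{2me₁}⟩ ≤ 64⟨σ₀σ_{8me₁}⟩`), then eventually in the box size `n`,
`pinchScreen n n m = 1 - P^{0 up,e₂ dn}_{Λ_n}[0 ↔ e₂] ≤ (1 - P_∞[0 ↔ e₂]) + m^{-κ} ≤ (4096·max(C,0) + 1) m^{-κ}`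
(energy factorisation (3.11) + the gap; MMS in the sup norm; box passage
`tendsto_sourcedDoubleCurrentLaw_real_openConn`; the dictionary `ScreeningIdentity`) — the body of the
landed `stub_screeningDecay`, verbatim. [cite: AizenmanDuminilCopinAnnals2021, eq. (3.11) and Lemma A.1] -/
theorem eventually_pinchScreen_le_of_doubling (hSI : ScreeningIdentity) {κ C : ℝ} (hκ : 0 < κ)
    (hC : ∀ m : ℕ, 1 ≤ m →
      criticalCorr 3 4 ![0, e₂, up m, dn m] - cc2 0 e₂ * cc2 (up m) (dn m) ≤
        C * (2 * (m : ℝ)) ^ (-κ) * criticalTwoPoint 3 (xR m) ^ 2)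
    {m : ℕ} (hm : 1 ≤ m) (hdoub : cc2 0 (xR m) ≤ 64 * cc2 0 (xR (4 * m))) :
    ∀ᶠ n : ℕ in atTop, pinchScreen n n m ≤ (max C 0 * 4096 + 1) * (m : ℝ) ^ (-κ) := by
  have hβ : 0 < criticalBeta 3 := criticalBeta_pos_holds (d := 3) (by norm_num)
  haveI := isProbabilityMeasure_sourcedDoubleCurrentLawInf (d := 3) hβ
    (even_card_singleton_symmDiff (0 : Site 3) (up m)) (even_card_singleton_symmDiff e₂ (dn m))
  have hPinf1 : (sourcedDoubleCurrentLawInf 3 (criticalBeta 3) ({0} ∆ {up m}) ({e₂} ∆ {dn m})).real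
      (openConn 0 e₂) ≤ 1 := measureReal_le_one
  have hm0 : (0 : ℝ) < m := by exact_mod_cast hm
  have hmk : (0 : ℝ) < (m : ℝ) ^ (-κ) := Real.rpow_pos_of_pos hm0 _
  -- (i) + (iii): the infinite-volume avoidance at a doubling scale
  have hinf : 1 - (sourcedDoubleCurrentLawInf 3 (criticalBeta 3) ({0} ∆ {up m}) ({e₂} ∆ {dn m})).real
      (openConn 0 e₂) ≤ max C 0 * 4096 * (m : ℝ) ^ (-κ) := by
    have h1 := mul_one_sub_probInf_le (hC m hm)
    rw [softPackageNoBubble_criticalCorr.two (xR m)] at h1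
    have hgpos : 0 < cc2 0 (xR (4 * m)) := softPackageNoBubble_criticalCorr.pos 0 (xR (4 * m))
    have hG1 : cc2 0 (xR (4 * m)) ≤ cc2 0 (up m) := cc2_xR_four_mul_le_cc2_up m
    have hG2 : cc2 0 (xR (4 * m)) ≤ cc2 e₂ (dn m) := cc2_xR_four_mul_le_cc2_e₂_dn hm
    have hx0 : 0 ≤ cc2 0 (xR m) := (softPackageNoBubble_criticalCorr.pos 0 (xR m)).le
    have h2m : (2 * (m : ℝ)) ^ (-κ) ≤ (m : ℝ) ^ (-κ) :=
      Real.rpow_le_rpow_of_nonpos hm0 (by linarith) (by linarith [hκ.le])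
    have h2m0 : 0 ≤ (2 * (m : ℝ)) ^ (-κ) := Real.rpow_nonneg (by positivity) _
    have hsq : cc2 0 (xR m) ^ 2 ≤ (64 * cc2 0 (xR (4 * m))) ^ 2 := pow_le_pow_left₀ hx0 hdoub 2
    have hA : cc2 0 (xR (4 * m)) * cc2 0 (xR (4 * m)) *
        (1 - (sourcedDoubleCurrentLawInf 3 (criticalBeta 3) ({0} ∆ {up m}) ({e₂} ∆ {dn m})).real
          (openConn 0 e₂)) ≤
        cc2 0 (up m) * cc2 e₂ (dn m) *
        (1 - (sourcedDoubleCurrentLawInf 3 (criticalBeta 3) ({0} ∆ {up m}) ({e₂} ∆ {dn m})).real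
          (openConn 0 e₂)) := by
      apply mul_le_mul_of_nonneg_right _ (by linarith)
      exact mul_le_mul hG1 hG2 hgpos.le (hgpos.le.trans hG1)
    have hB1 : C * (2 * (m : ℝ)) ^ (-κ) * cc2 0 (xR m) ^ 2 ≤
        max C 0 * (2 * (m : ℝ)) ^ (-κ) * cc2 0 (xR m) ^ 2 :=
      mul_le_mul_of_nonneg_right (mul_le_mul_of_nonneg_right (le_max_left _ _) h2m0) (sq_nonneg _)
    have hB2 : max C 0 * (2 * (m : ℝ)) ^ (-κ) * cc2 0 (xR m) ^ 2 ≤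
        max C 0 * (m : ℝ) ^ (-κ) * (64 * cc2 0 (xR (4 * m))) ^ 2 :=
      mul_le_mul (mul_le_mul_of_nonneg_left h2m (le_max_right _ _)) hsq (sq_nonneg _)
        (mul_nonneg (le_max_right _ _) hmk.le)
    have hchain := hA.trans (h1.trans (hB1.trans hB2))
    have hC' : (1 - (sourcedDoubleCurrentLawInf 3 (criticalBeta 3) ({0} ∆ {up m}) ({e₂} ∆ {dn m})).real
          (openConn 0 e₂)) * (cc2 0 (xR (4 * m)) * cc2 0 (xR (4 * m))) ≤
        (max C 0 * 4096 * (m : ℝ) ^ (-κ)) * (cc2 0 (xR (4 * m)) * cc2 0 (xR (4 * m))) := by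
      calc (1 - (sourcedDoubleCurrentLawInf 3 (criticalBeta 3) ({0} ∆ {up m}) ({e₂} ∆ {dn m})).real
              (openConn 0 e₂)) * (cc2 0 (xR (4 * m)) * cc2 0 (xR (4 * m)))
          = cc2 0 (xR (4 * m)) * cc2 0 (xR (4 * m)) *
              (1 - (sourcedDoubleCurrentLawInf 3 (criticalBeta 3) ({0} ∆ {up m}) ({e₂} ∆ {dn m})).real
                (openConn 0 e₂)) := by ring
        _ ≤ max C 0 * (m : ℝ) ^ (-κ) * (64 * cc2 0 (xR (4 * m))) ^ 2 := hchain
        _ = (max C 0 * 4096 * (m : ℝ) ^ (-κ)) * (cc2 0 (xR (4 * m)) * cc2 0 (xR (4 * m))) := by ring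
    exact le_of_mul_le_mul_right hC' (by positivity)
  -- (ii) box passage
  have hlim := tendsto_sourcedDoubleCurrentLaw_real_openConn (d := 3) (by norm_num) hβ le_rfl
    0 (up m) e₂ (dn m)
  have hev : ∀ᶠ n : ℕ in atTop,
      (sourcedDoubleCurrentLawInf 3 (criticalBeta 3) ({0} ∆ {up m}) ({e₂} ∆ {dn m})).real
          (openConn 0 e₂) - (m : ℝ) ^ (-κ) <
        (sourcedDoubleCurrentLaw 3 n (criticalBeta 3) ({0} ∆ {up m}) ({e₂} ∆ {dn m})).real
          (openConn 0 e₂) :=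
    hlim.eventually_const_lt (by linarith)
  obtain ⟨L₀, hL₀⟩ := exists_forall_subset_box 3 ({0, up m, e₂, dn m} : Finset (Site 3))
  filter_upwards [hev, eventually_ge_atTop L₀] with n hn hnL
  have hsub := hL₀ n hnL
  have h0 : (0 : Site 3) ∈ box 3 n := hsub (by simp)
  have hup : up m ∈ box 3 n := hsub (by simp)
  have he₂ : e₂ ∈ box 3 n := hsub (by simp)
  have hdn : dn m ∈ box 3 n := hsub (by simp)
  rw [pinchScreen_full, hSI n 0 (up m) e₂ (dn m) h0 hup he₂ hdn]
  calc 1 - (sourcedDoubleCurrentLaw 3 n (criticalBeta 3) ({0} ∆ {up m}) ({e₂} ∆ {dn m})).real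
          (openConn 0 e₂)
      ≤ 1 - (sourcedDoubleCurrentLawInf 3 (criticalBeta 3) ({0} ∆ {up m}) ({e₂} ∆ {dn m})).real
          (openConn 0 e₂) + (m : ℝ) ^ (-κ) := by linarith
    _ ≤ max C 0 * 4096 * (m : ℝ) ^ (-κ) + (m : ℝ) ^ (-κ) := by linarith
    _ = (max C 0 * 4096 + 1) * (m : ℝ) ^ (-κ) := by ring

/-! ### The stub -/

/-- **S2-dy — one-pinch screening decay along powers of two.** `ScreeningIdentity → OnePinchGap →
OnePinchScreeningDecayDyadic`: with `κ = κ'` and `C' = 4096·max(C,0) + 1`, for the infinitely many dyadic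
doubling scales `2^i` (`frequently_doubling_dyadic`), eventually in the box size `n`,
`pinchScreen n n (2^i) ≤ C' (2^i)^{-κ'}` (`eventually_pinchScreen_le_of_doubling` at `m = 2^i ≥ 1`; the cast
`((2^i : ℕ) : ℝ) = (m : ℝ)` is syntactic). [cite: AizenmanDuminilCopinAnnals2021, eq. (3.11) and Lemma A.1] -/
theorem stub_decayDyadic : ScreeningIdentity → OnePinchGap → OnePinchScreeningDecayDyadic := by
  intro hSI hGap
  obtain ⟨κ, C, hκ, hC⟩ := hGap
  refine ⟨κ, max C 0 * 4096 + 1, hκ, ?_⟩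
  refine frequently_doubling_dyadic.mono ?_
  intro i hdoub
  exact eventually_pinchScreen_le_of_doubling hSI hκ hC Nat.one_le_two_pow hdoub

end Summit.CriticalPhenomena.Ising3DConformalLimit.EnergyNotSigmaSquaredGapForcesFarMerging

end
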